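import Mathlib
import Summits.HodgeConjecture.HodgeConjecture.Theses.PadicSemiregularLift
import Summits.HodgeConjecture.HodgeConjecture.Cruxes.SemiregularSeedsOnAnchors.TypedCrux
import Literature.AlgebraicGeometry.Crystalline.BlochEsnaultKerzLifting
import Literature.AlgebraicGeometry.Motives.SupersingularAbelianVariety
import Literature.AlgebraicGeometry.Motives.AbelianVarietyProduct
import Literature.AlgebraicGeometry.HodgeTheory.AtiyahClassTraceReal
import Literature.AlgebraicGeometry.Modules.TensorProduct
import Literature.AlgebraicGeometry.Modules.PushforwardUnitHom
import Literature.AlgebraicGeometry.Modules.LocalFrames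
import Literature.AlgebraicGeometry.KTheory.GrothendieckGroup
import HarnessLib.Audit

/-!
# Line `cross-ideal-orbit-transport` — skeleton for crux `SemiregularSeedsOnAnchors`
(item stmt-HodgeConjecture-13941, route `PadicSemiregularLift`; crux-plan, planner
`planner-cruxplan-stmt-HodgeConjecture-13941-cross-ideal-orbit-tr-0`, 2026-08-16)

## The crux, the shared typed transcription, and this line's audited target

The crux P2a `SemiregularSeedsOnAnchors` is INFORMAL (signature null, no route declaration). The sibling
crux-plan seat (line `isogeny-untwist-superspecial`) published the SHARED typed transcription
`Cruxes/SemiregularSeedsOnAnchors/TypedCrux.lean`: a predicate `SemiregularSeedsOnAnchors C Θ HO` of the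
classical data (`C : CrystallineRealization p k`; `Θ : HigherSigma k` = the components `σ_q`, `q ≥ 2`,
AS DATA, degrees `0, 1` pinned to the REAL `sigmaZero`/`sigmaOne` of `HodgeTheory.AtiyahClassTraceReal`;
`HO` = "of Hodge origin"), over ALL anchors and all `r`, with conclusion `SeedSpan C Θ 𝒳 r α`. This file
IMPORTS it and reuses `SeedSpan` / `IsPadicSemiregular` verbatim.

This line serves one anchor class — `E⁴`-ANCHORS OF PRODUCT-DIAGONAL WEIL TYPE (`X_k ≅ E⁴`, `E`
supersingular, `Θ = ⊗ᵢ prᵢ^*𝒪_E(0_E)` the product principal polarisation, `η = diag(ι, ι, -ι, -ι)`,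
`ι² = -d`; `r = 2`; first instance `p = 11`, `d = 1`, TRIAGE-r1-3) — so it cannot conclude the all-anchor
predicate by name without restating the crux elsewhere (costume). Its audited target (`--crux-decl`) is
the LOCAL declaration

  `CrossOrbitSeedsOnWeilFourfoldAnchors` :
  for EVERY `Θ : HigherSigma k`, at every product-diagonal Weil `E⁴`-anchor and for every `α` in the
  `K`-span of the de Rham Weil classes, `SeedSpan C Θ 𝒳 2 α` — the shared typed crux's own conclusion,
  WITHOUT its hypotheses (a) `φ`-Tate / (b) Hodge origin (so: stronger, on its anchor class).

HOW σ IS MADE REAL HERE. Transported cross ideals are detected by `σ₂` (the `4`-dimensional block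
`T_x ⊗ T_y ⊂ Ext¹ ⊗ Ext¹ ⊂ Ext²(𝓘_Σ, 𝓘_Σ)` is killed by `σ₀ = tr ⊗ tr` and by `σ₁`, and seen only by
`σ₂ ∋ tr(·At₁) ⊗ tr(·At₂)`), so `𝓘_Σ` itself is `{0,1,2}`- but NOT `{0,1}`-semiregular. But `{0,1}`-
semiregularity of a TRANSPORT `Φ_γ(𝓘_Σ)` is the condition that the `18`-dimensional image `V_γ` of
total `σ` misses the summand `H⁴(Ω²)` of `HH₋₂(X_k) = H²(𝒪) ⊕ H³(Ω¹) ⊕ H⁴(Ω²)` (`6 + 16 + 6 = 28`;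
`18 + 6 ≤ 28`). Here `HH₋₂ = Λ²L^*`, `L = Lie(A × Â) = HH¹` (`A = X_k`), the three summands being
`Λ²(Lie Â)^*`, `(Lie Â)^* ⊗ (Lie A)^*`, `Λ²(Lie A)^*`, and `Φ_γ` acts through the TANGENT MAP of Orlov's
`f_γ ∈ Aut(A × Â)` (it acts on `Aut⁰ D^b = A × Â` by conjugation), i.e. — `A × Â = E⁸`, `Aut = GL₈(𝒪)`,
`𝒪 → End(Lie E) = k` the reduction modulo the prime `𝔓 | p` — through the FINITE group
`GL₈(𝒪/𝔓) = GL₈(𝔽_{p²})`: `V_γ = Λ²(T̄_γ)·V₀` with `V₀ = Λ²(Lie Â)^* ⊕ (8 of 16) ⊕ (4 of 6)`. So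
"σ₂-AVOIDANCE" (`stub_zeroOneAvoidance`) is a condition on `γ mod 𝔓` in a large finite unitary-type
group, nearly independent of the GLOBAL class conditions on `γ` (weak approximation at `p`); `Φ_𝒫`-type
elements exchange the roles of `σ₀` and `σ₂`, block-diagonal ones (automorphisms, twists) preserve the
three summands. With it the seeds are `IsZeroOneSemiregular` on REAL carriers, hence
`IsPadicSemiregular Θ p` for EVERY `Θ` (`isPadicSemiregular_of_isZeroOneSemiregular`, TypedCrux) —
strictly stronger than the crux's notion, welcome downstream (Buchweitz–Flenner `{1,2}`-semiregularity is
the classical lifting hypothesis), and it kills the cheap witnesses of the class-level stubs (direct sums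
of line bundles, syzygy bundles of lifted Markman cycles: `ext² > 22 = 6 + 16` forces a kernel, Disproof
§B). FALLBACK if σ₂-avoidance is refuted: total semiregularity via Lemma B (`ext² = 18 = ρ₂`, Disproof
§A′/§E′) once `σ_q`, `q ≥ 2`, has a carrier (definition request).

Crux at these anchors ⟸ `CrossOrbitSeedsOnWeilFourfoldAnchors` ∧ [MZ] (Moonen–Zarhin: a Hodge-origin
`φ`-Tate class at an abelian-fourfold anchor of Weil type `(Θ,η)` lies in `bo(Kθ² ⊕ W_K) + Lef²(X_K)`;
untypable — Hodge origin is TypedCrux's free predicate `HO` — and not needed: the typed target covers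
the whole `K`-span `weilTarget`).

## The line (idea card `Ideas/cross-ideal-orbit-transport.md`, re-aimed by TRIAGE-r1-1/2/3)

Semiregularity is a derived invariant, `𝓘_Σ = 𝓘_x ⊠ 𝓘_y` (`Σ = (x × T₂) ∪ (T₁ × y)`, `Tᵢ = E²`) is
semiregular (`ext² = 1 + 4·4 + 1 = 18 = ρ₂`, Disproof §E′), and on the superspecial fibre
`Aut D^b(E⁴) ↠ Γ = U(E⁴ × Ê⁴) ≅ {g ∈ GL₈(𝒪) : g†Jg = J}` is an ARITHMETIC group (Orlov), Zariski-dense in a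
`ℚ`-form of `Spin₁₆` (`SO*(16)` at `∞`), acting on `N(E⁴)_ℚ = K₀(E⁴)_ℚ` (`= H^{ev}`, the anchor being
cohomologically supersingular; `K₀_ℚ = N_ℚ` by Kahn 2003 + LenstraZarhin1993). TRANSPORT `𝓘_Σ` by `γ ∈ Γ`
(composed with `Stab_Γ(N_R) ∋ Φ_Θ, ⊗Θ` from the start, TRIAGE-r1-3) into the generic Hodge ring
`N_R(Θ,η) = ℚ[θ] ⊕ W_N`. TRIAGE-r1-1 (J-descent on the canonical `so(7) ⊕ so(7)` splitting of
`v₀ = ch 𝓘_Σ = (1 - pt₁)(1 - pt₂)`) killed the card's displayed target `(1 - λw₊)(1 - λ̄w₋)`; reachable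
targets are COSH-TYPE `b e^{cθ} + b̄ e^{c̄θ} + a w₊ + a' w₋` — classes in `ℚ[θ] ⊕ W_N`, which is all the
typed layer asks (`thetaSpan ⊔ weilEigenspace`).

CLASS-LEVEL CONDITIONS ARE C-FREE, in `K₀(X_k) ⊗ ℚ` (`KTheory.KZeroRat`): `thetaSpan = ℚ⟨[Θ^{⊗t}]⟩`
(`t ≤ 4`; `= ℚ[θ]`, Vandermonde), `weilEigenspace = ker q_d(ψ^*)`, `ψ = 1 + η`,
`q_d(x) = x² - 2(1 - 6d + d²)x + (1 + d)⁴` (roots `(1 ± √-d)⁴`, the eigenvalues of `(1+η)^*` on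
`Λ⁴V₊ ⊕ Λ⁴V₋` and on no other `Λ^aV₊ ⊗ Λ^bV₋`, by the norm `(1+d)^{(a+b)/2}`), `= W_N`. The realization
`C` enters only through `chKZeroRat`/`bo`/`fil` (tree, BlochEsnaultKerzLifting) and as anchor HYPOTHESES
(`liftsTheta`, `weilDisc`), never inside a closed `∀ C`-claim: junk-safe. Everything is stated ON the
special fibre itself (`WeilCrossDatumOn Y`, `Y ≅ E⁴` part of the datum): no transport along `X_k ≅ E⁴`.

## Registered stubs (5), hardest first, and the composition

* `stub_coherentCrossSeed` (HARDEST; F1 transporter ⊕ coherent sheafness): ONE simple coherent sheaf on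
  `Y ≅ E⁴` with class in `ℚ[Θ] ⊕ E_W` and non-zero Weil part.
* `stub_secondWeilDirection`: one ⇒ two with Weil parts spanning `E_W` (`d = 1`: pull back by
  `diag(ι,1,1,1)`, acting on `Λ⁴V₊ ⊕ Λ⁴V₋` by `(i,-i)`; block swap `(12)(34)` in general).
* `stub_locallyFreeUpgrade` (Mukai IT through `Stab_Γ(N_R)`): coherent ⇒ finite locally free seeds.
* `stub_zeroOneAvoidance` (σ₂-avoidance, REAL σ): locally free seeds ⇒ `{0,1}`-semiregular ones.
* `stub_thetaHatchLefschetz` (S–M, provable now): `bo ch₂(lifted Θ-powers) ⊆ Lef²(X_K)` given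
  `ch^dR = exp c₁` on line bundles.
`CrossOrbitSeedsOnWeilFourfoldAnchors_of` (no `sorry`) composes them with the proved glue: classes in
`ℚ[Θ] ⊕ E_W` satisfy BEK's Hodge condition on the anchor (`hodgeCondition_of_liftsTo` for the `Θ`-part —
`liftsTheta` —, the `weilDisc` hypothesis for the Weil part; `hodgeSubmodule` is a `ℚ`-subspace),
`{0,1}` ⇒ p-adic semiregularity for every `Θ`, and `weilTarget ≤ thetaHatch ⊔ K⟨bo ch₂ F₁, bo ch₂ F₂⟩`.

Disproof.lean (cdisprove cycle 1) read in full; crux informal ⇒ NO `_false_without_<H>` theorem; landed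
Negative lemmas (`Theorems/SemiregularSeedsOnAnchors/Negative/SemiregularityCarrier.lean`) are the checked
shadows §A/§A′/§B/§C/§D/§E — honoured: §A (σ-as-data stays out; `σ₀, σ₁` are the REAL maps), §A′/§B
(Lemma B; forced kernels `28` total / `22` for `{0,1}`: transports sit at `18`), §D2 (cosh targets are
4-pure-spinor, not two-exponential), §D3/§D4 (nothing is untwisted: `c₁ ∈ ℚθ` by the choice of `γ`), §E
(the `ℚ(√-3)` coherent `𝓘_Z` is the model for STUB 1; "no locally free seed in the bare family" is why
STUB 3 goes through `Stab_Γ(N_R)`), §F(5) (kills must be autoequivalence-invariant: this is the converse).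
No stub is an instance of a landed Negative lemma. `ledger negatives --problem HodgeConjecture`: 2 entries
(K3 lattice `stmt-12555`, Fermat multisets `stmt-11121`), unrelated.
-/

set_option linter.dupNamespace false

noncomputable section

open CategoryTheory CategoryTheory.Limits AlgebraicGeometry MonoidalCategory
open scoped Isocrystal
open Literature.AlgebraicGeometry.Motives Literature.AlgebraicGeometry.Motives.WittScheme
open Literature.AlgebraicGeometry.Modules Literature.AlgebraicGeometry.KTheory
open Literature.AlgebraicGeometry.HodgeTheory

universe u

namespace Summit.HodgeConjecture.HodgeConjecture.Cruxes.SemiregularSeedsOnAnchors.CrossIdealOrbitTransport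

/-! ## §1 The product-diagonal Weil cross datum ON a `k`-scheme `Y ≅ E⁴` (C-free vocabulary) -/

/-- A PRODUCT-DIAGONAL WEIL CROSS DATUM on the `k`-scheme `Y`: a supersingular elliptic curve `E/k`,
an endomorphism `ι` with `ι ∘ ι = -d` (`d ≥ 1`; `K_η = ℚ(√-d)`), and an identification `e : Y ≅ E⁴`.
Everything else is CONSTRUCTED: `η = diag(ι, ι, -ι, -ι)` (tangent signature `(2,2)`; NOT
`diag(ι,ι,ι,ι)`, signature `(4,0)`, no Weil lift — CRUX-ATTACK-g2), `ψ = 1 + η`, `Θ = ⊗ᵢ prᵢ^* 𝒪_E(0_E)`,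
all transported to `Y` along `e`. First instance (TRIAGE-r1-3): `p = 11`, `d = 1`, `ι² = -1`. -/
structure WeilCrossDatumOn (k : Type u) [Field k] (Y : SchemeOver k) where
  /-- the supersingular elliptic curve -/
  E : AbelianVariety k
  isSupersingular : E.IsSupersingularEllipticCurve
  /-- complex multiplication on the special fibre, `ι² = -d`, `d ≥ 1` -/
  ι : E ⟶ E
  d : ℕ
  d_pos : 0 < d
  ι_sq : ι ≫ ι = -((d : ℤ) • 𝟙 E)
  /-- `Y` is `E⁴` -/
  e : Y ≅ (E.powSucc 3).X

namespace WeilCrossDatumOn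

variable {k : Type u} [Field k] {Y : SchemeOver k} (D : WeilCrossDatumOn k Y)

/-- `E⁴` as an abelian variety (`((E × E) × E) × E`, the tree's `powSucc 3`). -/
abbrev A : AbelianVariety k := D.E.powSucc 3

/-- The endomorphism `f × g` of a binary product of abelian varieties. -/
def endProd {A B : AbelianVariety k} (f : A ⟶ A) (g : B ⟶ B) : A.prod B ⟶ A.prod B :=
  AbelianVariety.prodLift (AbelianVariety.fst A B ≫ f) (AbelianVariety.snd A B ≫ g)

/-- The Weil endomorphism `η = diag(ι, ι, -ι, -ι)` of `E⁴`. -/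
def eta : D.A ⟶ D.A :=
  endProd (endProd (endProd D.ι D.ι) (-D.ι)) (-D.ι)

/-- `ψ = 1 + η` on `E⁴`: on `Λ^a V₊ ⊗ Λ^b V₋` its pull-back acts by `(1 + √-d)^a (1 - √-d)^b`. -/
def psi : D.A ⟶ D.A := 𝟙 D.A + D.eta

/-- `ψ` transported to `Y` along `e`. -/
def psiHom : Y.left ⟶ Y.left :=
  D.e.hom.left ≫ AbelianVariety.Hom.toSchemeHom D.psi ≫ D.e.inv.left

/-- The ideal sheaf `𝒪_E(-0_E)` of the origin: kernel of the restriction `𝒪_E → 0_* 𝒪_{Spec k}`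
along the unit section of the group scheme `E`. -/
def originIdeal : D.E.X.left.Modules :=
  kernel (pushforwardUnitHom (MonObj.one : 𝟙_ (SchemeOver k) ⟶ D.E.X).left (𝟙 D.E.X.left))

/-- `𝒪_E(0_E) = 𝒪_E(-0_E)^∨`, the degree-one line bundle of the origin. -/
def originBundle : D.E.X.left.Modules := dual D.originIdeal

/-- The four projections `E⁴ → E`. -/
def proj : Fin 4 → (D.A ⟶ D.E)
  | ⟨0, _⟩ => AbelianVariety.fst _ _ ≫ AbelianVariety.fst _ _ ≫ AbelianVariety.fst _ _
  | ⟨1, _⟩ => AbelianVariety.fst _ _ ≫ AbelianVariety.fst _ _ ≫ AbelianVariety.snd _ _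
  | ⟨2, _⟩ => AbelianVariety.fst _ _ ≫ AbelianVariety.snd _ _
  | ⟨3, _⟩ => AbelianVariety.snd _ _

/-- The PRODUCT PRINCIPAL POLARISATION `Θ = ⊗ᵢ prᵢ^* 𝒪_E(0_E)` of `E⁴` (`θ = c₁(Θ)`, `θ⁴ = 24·pt`,
`η^*θ = dθ`). -/
def thetaBundle : D.A.X.left.Modules :=
  tensorObj (tensorObj (tensorObj
    ((Scheme.Modules.pullback (AbelianVariety.Hom.toSchemeHom (D.proj 0))).obj D.originBundle)
    ((Scheme.Modules.pullback (AbelianVariety.Hom.toSchemeHom (D.proj 1))).obj D.originBundle))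
    ((Scheme.Modules.pullback (AbelianVariety.Hom.toSchemeHom (D.proj 2))).obj D.originBundle))
    ((Scheme.Modules.pullback (AbelianVariety.Hom.toSchemeHom (D.proj 3))).obj D.originBundle)

/-- `Θ^{⊗ t}` transported to `Y` (`t = 0`: `𝒪`). -/
abbrev thetaPow (t : ℕ) : Y.left.Modules :=
  (Scheme.Modules.pullback D.e.hom.left).obj (tensorPow D.thetaBundle t)

/-- The THETA SPAN `ℚ⟨[Θ^{⊗t}] : t ≤ 4⟩ ⊆ K₀(Y)_ℚ`; classically `K₀(E⁴)_ℚ = N(E⁴)_ℚ` (Kahn 2003 +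
Lenstra–Zarhin) and `[Θ^{⊗t}] ↦ e^{tθ}`, `t = 0..4`, span `ℚ[θ] = ℚ⟨1, θ, …, θ⁴⟩` (Vandermonde).
Finite local freeness of `Θ^{⊗t}` is a WITNESS inside the generating set, not a proof obligation. -/
def thetaSpan : Submodule ℚ (KZeroRat Y.left) :=
  Submodule.span ℚ {x | ∃ (t : ℕ) (h : IsFiniteLocallyFree (D.thetaPow t)), t ≤ 4 ∧
    x = KZeroRat.of (D.thetaPow t) h}

/-- `q_d(x) = x² - 2(1 - 6d + d²) x + (1 + d)⁴ ∈ ℚ[x]`, roots `(1 ± √-d)⁴` (`d = 1`: `(x + 4)²`). -/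
def weilPoly : Polynomial ℚ :=
  Polynomial.X ^ 2 - Polynomial.C (2 * (1 - 6 * (D.d : ℚ) + (D.d : ℚ) ^ 2)) * Polynomial.X +
    Polynomial.C ((1 + (D.d : ℚ)) ^ 4)

/-- The WEIL EIGENSPACE `E_W = ker q_d(ψ^*) ⊆ K₀(Y)_ℚ` — classically the rational Weil plane
`W_N = N² ∩ (Λ⁴V₊ ⊕ Λ⁴V₋)`, a `ℚ`-plane (a `K_η`-line; Disproof.lean D5, TRIAGE-r1-1 (b)). -/
def weilEigenspace : Submodule ℚ (KZeroRat Y.left) :=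
  LinearMap.ker (Polynomial.aeval (KZeroRat.map D.psiHom) D.weilPoly)

end WeilCrossDatumOn

/-! ## §2 Simple sheaves, resolution classes, seeds (C-free; σ₀, σ₁ REAL) -/

section Seeds

variable {X : Scheme.{u}}

/-- `F` is SIMPLE: every endomorphism acts on all sections as multiplication by (the restriction of)
one global function (`End F = k` on `E⁴`). Guards the class-level stubs against direct sums etc.; the
intended witnesses — derived transports of the simple `𝓘_Σ` — are simple. -/
def IsSimpleSheaf (F : X.Modules) : Prop :=
  ∀ f : F ⟶ F, ∃ a : X.ringCatSheaf.val.obj (Opposite.op ⊤),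
    ∀ (U : X.Opens) (s : F.val.obj (Opposite.op U)),
      f.val.app (Opposite.op U) s = (X.ringCatSheaf.val.map (homOfLE (le_top : U ≤ ⊤)).op a) • s

/-- `x ∈ K₀(X)_ℚ` IS THE CLASS OF THE COHERENT SHEAF `F`, witnessed by a finite locally free
resolution of length `≤ 4` (enough on a smooth projective fourfold):
`0 → P₄ → P₃ → P₂ → P₁ → P₀ → F → 0` exact and `x = Σᵢ (-1)ⁱ [Pᵢ]`. -/
def IsResolutionClassOf (F : X.Modules) (x : KZeroRat X) : Prop :=
  ∃ (P₀ P₁ P₂ P₃ P₄ : X.Modules) (h₀ : IsFiniteLocallyFree P₀) (h₁ : IsFiniteLocallyFree P₁)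
    (h₂ : IsFiniteLocallyFree P₂) (h₃ : IsFiniteLocallyFree P₃) (h₄ : IsFiniteLocallyFree P₄)
    (ε : P₀ ⟶ F) (d₁ : P₁ ⟶ P₀) (d₂ : P₂ ⟶ P₁) (d₃ : P₃ ⟶ P₂) (d₄ : P₄ ⟶ P₃)
    (w₀ : d₁ ≫ ε = 0) (w₁ : d₂ ≫ d₁ = 0) (w₂ : d₃ ≫ d₂ = 0) (w₃ : d₄ ≫ d₃ = 0),
    Epi ε ∧ Mono d₄ ∧ (ShortComplex.mk d₁ ε w₀).Exact ∧ (ShortComplex.mk d₂ d₁ w₁).Exact ∧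
      (ShortComplex.mk d₃ d₂ w₂).Exact ∧ (ShortComplex.mk d₄ d₃ w₃).Exact ∧
    x = KZeroRat.of P₀ h₀ - KZeroRat.of P₁ h₁ + KZeroRat.of P₂ h₂ - KZeroRat.of P₃ h₃ +
      KZeroRat.of P₄ h₄

end Seeds

section SeedProps

variable {k : Type u} [Field k] {Y : SchemeOver k}

/-- ONE COHERENT CROSS-ORBIT SEED: a simple coherent sheaf on `Y ≅ E⁴` whose class lies in
`ℚ[Θ] ⊕ E_W` with NON-ZERO Weil part. Intended witness: `Φ_γ(𝓘_Σ)[n]` for `γ ∈ Γ` solving the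
transporter problem F1 (model: Disproof.lean §E's `𝓘_Z` for `K = ℚ(√-3)` on Markman's `(S × Ŝ, η_P, Ξ_P)`,
a different `(Θ,η)`-type; no instance is known for the product-diagonal type). -/
def CoherentCrossSeed (D : WeilCrossDatumOn k Y) : Prop :=
  ∃ (F : Y.left.Modules) (x : KZeroRat Y.left),
    IsSimpleSheaf F ∧ IsResolutionClassOf F x ∧ x ∈ D.thetaSpan ⊔ D.weilEigenspace ∧
    x ∉ D.thetaSpan

/-- TWO COHERENT CROSS-ORBIT SEEDS whose Weil parts SPAN `E_W` modulo `ℚ[Θ]` (classically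
`dim_ℚ E_W = 2`; two directions are needed because `W_N ⊗ ℚ_p = T² ∩ W_cris` is a `K_η`-LINE). -/
def CoherentCrossSeeds (D : WeilCrossDatumOn k Y) : Prop :=
  ∃ (F₁ F₂ : Y.left.Modules) (x₁ x₂ : KZeroRat Y.left),
    IsSimpleSheaf F₁ ∧ IsSimpleSheaf F₂ ∧ IsResolutionClassOf F₁ x₁ ∧ IsResolutionClassOf F₂ x₂ ∧
    x₁ ∈ D.thetaSpan ⊔ D.weilEigenspace ∧ x₂ ∈ D.thetaSpan ⊔ D.weilEigenspace ∧
    D.weilEigenspace ≤ D.thetaSpan ⊔ (ℚ ∙ x₁) ⊔ (ℚ ∙ x₂)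

/-- TWO LOCALLY FREE CROSS-ORBIT SEEDS (the crux's "finite locally free `E_i`"). Intended witnesses:
the IT₀-transforms `Φ_Θ(F ⊗ Θ^t)`, `t ≫ 0`, of the coherent seeds. -/
def LocallyFreeCrossSeeds (D : WeilCrossDatumOn k Y) : Prop :=
  ∃ (F₁ F₂ : Y.left.Modules) (h₁ : IsFiniteLocallyFree F₁) (h₂ : IsFiniteLocallyFree F₂),
    IsSimpleSheaf F₁ ∧ IsSimpleSheaf F₂ ∧
    KZeroRat.of F₁ h₁ ∈ D.thetaSpan ⊔ D.weilEigenspace ∧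
    KZeroRat.of F₂ h₂ ∈ D.thetaSpan ⊔ D.weilEigenspace ∧
    D.weilEigenspace ≤ D.thetaSpan ⊔ (ℚ ∙ KZeroRat.of F₁ h₁) ⊔ (ℚ ∙ KZeroRat.of F₂ h₂)

/-- TWO `{0,1}`-SEMIREGULAR LOCALLY FREE CROSS-ORBIT SEEDS: as `LocallyFreeCrossSeeds`, and
`(σ₀, σ₁) : Ext²(Fᵢ, Fᵢ) → H²(Y, 𝒪) × H³(Y, Ω¹_{Y/k})` injective on the tree's REAL carriers
(`HodgeTheory.IsZeroOneSemiregular`) — hence p-adically semiregular for EVERY package of higher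
`σ_q` (`isPadicSemiregular_of_isZeroOneSemiregular`). -/
def SemiregularCrossSeeds (D : WeilCrossDatumOn k Y) : Prop :=
  ∃ (F₁ F₂ : Y.left.Modules) (h₁ : IsFiniteLocallyFree F₁) (h₂ : IsFiniteLocallyFree F₂),
    IsZeroOneSemiregular.{u + 1} h₁ ∧ IsZeroOneSemiregular.{u + 1} h₂ ∧
    KZeroRat.of F₁ h₁ ∈ D.thetaSpan ⊔ D.weilEigenspace ∧
    KZeroRat.of F₂ h₂ ∈ D.thetaSpan ⊔ D.weilEigenspace ∧
    D.weilEigenspace ≤ D.thetaSpan ⊔ (ℚ ∙ KZeroRat.of F₁ h₁) ⊔ (ℚ ∙ KZeroRat.of F₂ h₂)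

end SeedProps

/-! ## §2b Two linear-algebra lemmas (images of `ℚ`-spans under additive maps into `K`-spaces) -/

section LinAlg

/-- If `S ≤ S₁ ⊔ S₂` then `span_K f(S) ≤ span_K f(S₁) ⊔ span_K f(S₂)` for an additive `f`. -/
theorem span_image_le_of_le_sup {K' : Type*} [Field K'] {M : Type*} [AddCommGroup M] [Module ℚ M]
    {N : Type*} [AddCommGroup N] [Module K' N] (f : M →+ N) {S S₁ S₂ : Submodule ℚ M}
    (h : S ≤ S₁ ⊔ S₂) :
    Submodule.span K' (f '' (S : Set M)) ≤
      Submodule.span K' (f '' (S₁ : Set M)) ⊔ Submodule.span K' (f '' (S₂ : Set M)) := by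
  refine Submodule.span_le.mpr ?_
  rintro _ ⟨x, hx, rfl⟩
  obtain ⟨y, hy, z, hz, rfl⟩ := Submodule.mem_sup.mp (h hx)
  rw [map_add]
  exact Submodule.add_mem_sup (Submodule.subset_span ⟨y, hy, rfl⟩)
    (Submodule.subset_span ⟨z, hz, rfl⟩)

/-- The `K`-span of the image of a `ℚ`-line is contained in the `K`-line of the image. -/
theorem span_image_span_singleton_le {K' : Type*} [Field K'] {M : Type*} [AddCommGroup M]
    [Module ℚ M] {N : Type*} [AddCommGroup N] [Module K' N] (f : M →+ N)
    (hf : ∀ (a : ℚ) (x : M), f (a • x) = ((a : ℚ) : K') • f x) (x : M) :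
    Submodule.span K' (f '' ((ℚ ∙ x : Submodule ℚ M) : Set M)) ≤ K' ∙ f x := by
  refine Submodule.span_le.mpr ?_
  rintro _ ⟨y, hy, rfl⟩
  obtain ⟨a, rfl⟩ := Submodule.mem_span_singleton.mp hy
  rw [hf]
  exact Submodule.smul_mem _ _ (Submodule.mem_span_singleton_self _)

end LinAlg

/-! ## §3 Anchors: the crystalline realization enters, as hypotheses only -/

section Anchors

variable {p : ℕ} [Fact p.Prime] {k : Type u} [Field k] [CharP k p] [PerfectRing k p]

/-- `ch_r` on `K₀ ⊗ ℚ` is `ℚ`-linear for the `K`-structure restricted along `ℚ → K`. -/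
theorem chKZeroRat_smul (C : CrystallineRealization p k) (X : SchemeOver k) (r : ℕ) (a : ℚ)
    (ξ : KZeroRat X.left) :
    C.chKZeroRat X r (a • ξ) = ((a : ℚ) : K(p, k)) • C.chKZeroRat X r ξ := by
  induction ξ using TensorProduct.induction_on with
  | zero => rw [smul_zero, map_zero, smul_zero]
  | tmul b x =>
    rw [TensorProduct.smul_tmul', smul_eq_mul, C.chKZeroRat_tmul, C.chKZeroRat_tmul,
      Rat.cast_mul, mul_smul]
  | add x y hx hy => rw [smul_add, map_add, map_add, hx, hy, smul_add]

/-- `ξ ↦ bo (ch_r ξ) ∈ H²ʳ_dR(X_K/K)`: Berthelot–Ogus image of the crystalline Chern character of a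
`K₀ ⊗ ℚ`-class on the special fibre. -/
def boch (C : CrystallineRealization p k) (𝒳 : SchemeOver (WittVector p k)) (r : ℕ) :
    KZeroRat (specialFibre 𝒳).left →+ C.dR.obj (genericFibre 𝒳) (2 * r) :=
  (C.bo 𝒳 (2 * r)).toAddMonoidHom.comp (C.chKZeroRat (specialFibre 𝒳) r)

theorem boch_apply (C : CrystallineRealization p k) (𝒳 : SchemeOver (WittVector p k)) (r : ℕ)
    (ξ : KZeroRat (specialFibre 𝒳).left) :
    boch C 𝒳 r ξ = C.bo 𝒳 (2 * r) (C.chKZeroRat (specialFibre 𝒳) r ξ) := rfl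

theorem boch_smul (C : CrystallineRealization p k) (𝒳 : SchemeOver (WittVector p k)) (r : ℕ)
    (a : ℚ) (ξ : KZeroRat (specialFibre 𝒳).left) :
    boch C 𝒳 r (a • ξ) = ((a : ℚ) : K(p, k)) • boch C 𝒳 r ξ := by
  rw [boch_apply, boch_apply, chKZeroRat_smul, map_smul]

/-- The HODGE SUBMODULE of `K₀(X_k)_ℚ`: the classes satisfying Bloch–Esnault–Kerz's Hodge
condition (a) on `𝒳` (`C.HodgeConditionKZeroRat`, BlochEsnaultKerz2014pAdic Thm. 1.3 (a)); a
`ℚ`-subspace because `ch` is `ℚ`-linear and each `Fʳ` is a `K`-subspace. -/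
def hodgeSubmodule (C : CrystallineRealization p k) (𝒳 : SchemeOver (WittVector p k)) :
    Submodule ℚ (KZeroRat (specialFibre 𝒳).left) where
  carrier := {ξ | C.HodgeConditionKZeroRat 𝒳 ξ}
  zero_mem' := fun r => by
    rw [map_zero, map_zero]
    exact Submodule.zero_mem _
  add_mem' := fun {x y} hx hy r => by
    rw [map_add, map_add]
    exact Submodule.add_mem _ (hx r) (hy r)
  smul_mem' := fun a x hx r => by
    rw [chKZeroRat_smul, map_smul]
    exact Submodule.smul_mem _ _ (hx r)

theorem mem_hodgeSubmodule_iff (C : CrystallineRealization p k) (𝒳 : SchemeOver (WittVector p k))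
    (ξ : KZeroRat (specialFibre 𝒳).left) :
    ξ ∈ hodgeSubmodule C 𝒳 ↔ C.HodgeConditionKZeroRat 𝒳 ξ := Iff.rfl

variable (C : CrystallineRealization p k)

/-- A PRODUCT-DIAGONAL WEIL `E⁴`-ANCHOR (for the realization `C`): a smooth proper model `𝒳/W(k)` of
relative dimension `4`, a product-diagonal Weil cross datum ON its special fibre (`X_k ≅ E⁴`, the crux's
"X_k ∼ E⁴ at `p` inert in `K_d`", normalised), POLARISED by a lift of the product polarisation
(`Θ^{⊗t}`, `t ≤ 4`, lift to rank-one bundles — classically `t = 1` suffices), and lying in the WEIL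
DISC of `η`: every class of the Weil eigenspace satisfies the Hodge condition on `𝒳` (classical `C`:
`bo(W_N ⊗ K) ⊂ F²H⁴_dR(X_K/K)`, i.e. `η` deforms to a Weil structure of signature `(2,2)` on `X_K`;
Disproof.lean "Conventions", the 4-dimensional Weil disc `D_W`). Example: the CM lift `E_ι⁴/W` with the
diagonal action and the product polarisation (a p.p. abelian fourfold of Weil type, `K = ℚ(ι)`) and the
`W(𝔽̄_p)`-points of the Weil disc through it — the anchors AnchorsAtGenericHodgeLocusPoints supplies for
the p.p. `ℚ(ι)`-Weil locus. (The crux's anchor side-conditions `n + 6 < p`, cohomological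
supersingularity, torsion-free Hodge cohomology all hold here — `p ≥ 11`, `E⁴` superspecial, abelian
scheme — and are not needed by the composition, so they are not fields.) -/
structure WeilProductAnchor where
  /-- the model over the Witt vectors -/
  𝒳 : SchemeOver (WittVector p k)
  model : IsSmoothProperModel 4 𝒳
  /-- the special fibre is `E⁴` with its product-diagonal Weil structure -/
  D : WeilCrossDatumOn k (specialFibre 𝒳)
  /-- the product polarisation and its powers lift to line bundles on `𝒳` -/
  liftsTheta : ∀ t : ℕ, t ≤ 4 → ∃ L : 𝒳.left.Modules, HasRank L 1 ∧
    Nonempty (restrictSpecial 𝒳 L ≅ D.thetaPow t)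
  /-- the anchor lies in the Weil disc of `η` -/
  weilDisc : D.weilEigenspace ≤ hodgeSubmodule C 𝒳

variable {C}

/-- The THETA HATCH `K⟨bo ch₂(ℚ[Θ])⟩ ⊆ H⁴_dR(X_K/K)` (classical `C`: `K θ_K²`). -/
def thetaHatch (A : WeilProductAnchor C) :
    Submodule K(p, k) (C.dR.obj (genericFibre A.𝒳) (2 * 2)) :=
  Submodule.span K(p, k) (boch C A.𝒳 2 '' (A.D.thetaSpan : Set (KZeroRat _)))

/-- The WEIL TARGET `K⟨bo ch₂(E_W)⟩ ⊆ H⁴_dR(X_K/K)`: the de Rham realisations of the Weil classes of the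
anchor (classical `C`: `bo(W_N ⊗ K)`, containing every `φ`-Tate-on-the-nose Weil class, Disproof D5). -/
def weilTarget (A : WeilProductAnchor C) :
    Submodule K(p, k) (C.dR.obj (genericFibre A.𝒳) (2 * 2)) :=
  Submodule.span K(p, k) (boch C A.𝒳 2 '' (A.D.weilEigenspace : Set (KZeroRat _)))

variable (C) in
/-- `ch^dR` OF LINE BUNDLES IS `exp(c₁)` on generic fibres of smooth proper models: a property of the
classical realization (Grothendieck 1958; `ch(L) = Σ c₁(L)ʳ/r!`), consumed as a hypothesis — not
provable for an arbitrary `C`, whose `chDR` is only axiomatised additive, functorial, algebraic and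
`bo`-compatible. -/
def LineBundleChernDR : Prop :=
  ∀ ⦃n : ℕ⦄ ⦃𝒳 : SchemeOver (WittVector p k)⦄, IsSmoothProperModel n 𝒳 →
    ∀ (L : 𝒳.left.Modules), HasRank L 1 → ∀ r : ℕ,
      C.chDR (genericFibre 𝒳) (restrictGeneric 𝒳 L) r =
        ((Nat.factorial r : K(p, k))⁻¹) •
          C.dR.pow (genericFibre 𝒳) (C.chDR (genericFibre 𝒳) (restrictGeneric 𝒳 L) 1) r

end Anchors

/-! ## §4 The typed conclusion (the audited target) and the five stub statements -/

/-- **THE SHARED TYPED CRUX AT PRODUCT-DIAGONAL WEIL `E⁴`-ANCHORS** (`r = 2`; this line's audited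
target, `--crux-decl`). For `p ≥ 11`, `k` algebraically closed of characteristic `p`, every crystalline
realization `C` with `ch^dR = exp c₁` on line bundles, EVERY package `Θ : HigherSigma k` of higher
semiregularity components, every product-diagonal Weil `E⁴`-anchor `A` and every `α` in the `K`-span of its
de Rham Weil classes: `SeedSpan C Θ A.𝒳 2 α` — verbatim the conclusion of the shared typed crux
`SemiregularSeedsOnAnchors C Θ HO` (TypedCrux.lean): finitely many finite locally free, p-ADICALLY
SEMIREGULAR `E_i` on `X_k` with the Bloch–Esnault–Kerz Hodge condition in all degrees and
`α ∈ K-span{bo ch₂^cris(E_i)} + Lef²(X_K)`. No `φ`-Tate / Hodge-origin hypothesis on `α` is needed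
(stronger); the crux at these anchors follows with [MZ] (module docstring). -/
def CrossOrbitSeedsOnWeilFourfoldAnchors : Prop :=
  ∀ (p : ℕ) [Fact p.Prime] (k : Type) [Field k] [CharP k p] [PerfectRing k p] [IsAlgClosed k],
    11 ≤ p →
    ∀ (C : CrystallineRealization p k), LineBundleChernDR C →
    ∀ (Θ : HigherSigma k) (A : WeilProductAnchor C)
      (α : C.dR.obj (genericFibre A.𝒳) (2 * 2)), α ∈ weilTarget A →
      SeedSpan C Θ A.𝒳 2 α

/-- Statement of STUB 1 `stub_coherentCrossSeed` (HARDEST; the line's bet = F1 transporter ⊕ coherent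
sheafness): on every product-diagonal Weil cross datum over an algebraically closed field of
characteristic `p ≥ 11` there is ONE simple coherent cross-orbit seed reaching the Weil plane.
Intended proof: Orlov — every `γ ∈ Γ = U(E⁴ × Ê⁴) ≅ {g ∈ GL₈(𝒪) : g†Jg = J}` lifts to
`Φ_γ ∈ Aut D^b(E⁴)` with semi-homogeneous kernel; find `γ` (a word in `Λ(Aut E⁴)`, `⊗L`
(`L ∈ NS = Herm₄(𝒪)`), `Φ_Θ`) with `spin(γ)·v₀ ∈ ℚ[θ] ⊕ W_N`, Weil part `≠ 0`, for which `Φ_γ(𝓘_Σ)` is a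
SHEAF up to shift (kernel index pattern; IT). F1 = a genus / strong-approximation problem for the
`Stab_G(v₀) ⊇ SL₂(B) × SL₂(B)`-torsor over `N_R` (TRIAGE-r1-3). Zeroth filters for any proposed target
`u` (TRIAGE-r1-2): `⟨u,u⟩ = 4`, `ρ₂(u) = 18` (automatic on the orbit). Why it might fail:
`T(ℚ) ∩ Γ = ∅` for the product-diagonal genus (class-number / norm obstruction in `ℚ^×/Nrd`), or every
reachable `u ∈ N_R` is realised by complexes only. -/
def CoherentCrossSeedExists : Prop :=
  ∀ (p : ℕ) [Fact p.Prime] (k : Type) [Field k] [CharP k p] [IsAlgClosed k], 11 ≤ p →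
    ∀ (Y : SchemeOver k) (D : WeilCrossDatumOn k Y), CoherentCrossSeed D

/-- Statement of STUB 2 `stub_secondWeilDirection`: one coherent cross-orbit seed ⇒ two whose Weil
parts span `E_W`. For `d = 1` pull back by the automorphism `u = diag(ι, 1, 1, 1)` of `(E⁴, Θ)`
(commutes with `η`, acts on `Λ⁴V₊ ⊕ Λ⁴V₋` by `(i, -i)`: `{w, u^*w}` is always `ℚ`-independent); in
general the block swap `(12)(34)` (`η ↦ -η`, `w₊ ↔ w₋`; `q_d` is symmetric in `√-d ↦ -√-d`, so `E_W` is
preserved) unless the Weil part is swap-eigen, where a second transporter is needed. Pull-back along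
an automorphism preserves simplicity, resolutions and `ℚ[Θ]`. -/
def SecondWeilDirection : Prop :=
  ∀ (p : ℕ) [Fact p.Prime] (k : Type) [Field k] [CharP k p] [IsAlgClosed k], 11 ≤ p →
    ∀ (Y : SchemeOver k) (D : WeilCrossDatumOn k Y), CoherentCrossSeed D → CoherentCrossSeeds D

/-- Statement of STUB 3 `stub_locallyFreeUpgrade` (Mukai IT through `Stab_Γ(N_R) ∋ Φ_Θ, ⊗Θ`):
coherent cross-orbit seeds ⇒ finite locally free ones. For a coherent `F` on the p.p. abelian variety
`(E⁴, Θ)`, `F ⊗ Θ^t` is IT₀ for `t ≫ 0` uniformly over `Pic⁰` (Serre vanishing on a compact family), so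
`Φ_𝒫(F ⊗ Θ^t)` is a vector bundle (Mukai 1981 §2–3; characteristic-free); its class is `𝔉(e^{tθ}[F])`,
`𝔉` the cohomological Fourier transform, which preserves `ℚ[θ]` (Beauville: `θʲ/j! ↦ ±θ^{4-j}/(4-j)!`)
and `W = Λ⁴V₊ ⊕ Λ⁴V₋` (`V±` are `E_Θ`-Lagrangian) and is invertible on `W`: Weil parts keep spanning;
simplicity is a derived invariant. -/
def LocallyFreeUpgrade : Prop :=
  ∀ (p : ℕ) [Fact p.Prime] (k : Type) [Field k] [CharP k p] [IsAlgClosed k], 11 ≤ p →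
    ∀ (Y : SchemeOver k) (D : WeilCrossDatumOn k Y), CoherentCrossSeeds D → LocallyFreeCrossSeeds D

/-- Statement of STUB 4 `stub_zeroOneAvoidance` (σ₂-AVOIDANCE; real `σ₀, σ₁`): locally free
cross-orbit seeds ⇒ `{0,1}`-SEMIREGULAR ones. For a transport `F = Φ_γ(𝓘_Σ)[n]` total `σ` is injective
with `18`-dimensional image `V_γ ⊂ HH₋₂ = Λ²Lie(A×Â)^* = H²(𝒪) ⊕ H³(Ω¹) ⊕ H⁴(Ω²)` (`6 + 16 + 6`);
`(σ₀, σ₁)` is injective iff `V_γ ∩ H⁴(Ω²) = 0` — false for `𝓘_Σ` itself (`T_x ⊗ T_y ↠ H²(Ω¹) ⊗ H²(Ω¹)`),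
with `σ₀ ↔ σ₂` exchanged for `Φ_𝒫(𝓘_Σ)`. The Hochschild action of `Φ_γ` is `Λ²` of the tangent map of
`f_γ ∈ Aut(E⁸) = GL₈(𝒪)` on `Lie(E⁸) = k⁸`, which factors through the FINITE group `GL₈(𝒪/𝔓) =
GL₈(𝔽_{p²})`: `V_γ = Λ²(T̄_γ)V₀`. Claim: some `γ` in the class-admissible set (class in `ℚ[θ] ⊕ W`, sheaf
avatar, e.g. varying `t` and the `Aut(E⁴,Θ)`-factor in STUB 3) has `T̄_γ` moving `V₀` off
`Λ²(Lie A)^*` — a finite check on `γ mod 𝔓`, nearly independent of the global conditions (weak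
approximation at `p`). Why it might fail: the reductions `T̄_γ` of all sheafifying `γ` are block-triangular
for `Lie A ⊕ Lie Â` up to the Fourier flip, so `V_γ` always meets `H²(𝒪)` or `H⁴(Ω²)` in dimension `4`.
FALLBACK: total (`{0,1,2}`) semiregularity via Lemma B once `σ₂` has a carrier. -/
def ZeroOneAvoidance : Prop :=
  ∀ (p : ℕ) [Fact p.Prime] (k : Type) [Field k] [CharP k p] [IsAlgClosed k], 11 ≤ p →
    ∀ (Y : SchemeOver k) (D : WeilCrossDatumOn k Y), LocallyFreeCrossSeeds D → SemiregularCrossSeeds D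

/-- Statement of STUB 5 `stub_thetaHatchLefschetz` (S–M, provable now): granted `ch^dR = exp c₁` on
line bundles, `bo ch₂` of every lifted `Θ`-power is a Lefschetz class of the generic fibre:
`bo ch₂(Θ^t) = bo ch₂(L_t|X_k) = ch₂^dR(L_t|X_K) = ½ c₁^dR(L_t|X_K)² ∈ Lef²(X_K)` (`liftsTheta`,
`chCris_congr`, `bo_chCris`, `chDR_mem_ratAlgebraicClasses`, `pow_mem_lefschetzClasses`), then the
`ℚ`- and `K`-linearity of `boch` (`boch_smul`). -/
def ThetaHatchLefschetz : Prop :=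
  ∀ (p : ℕ) [Fact p.Prime] (k : Type) [Field k] [CharP k p] [PerfectRing k p],
    ∀ (C : CrystallineRealization p k), LineBundleChernDR C →
    ∀ (A : WeilProductAnchor C), thetaHatch A ≤ C.dR.lefschetzClasses (genericFibre A.𝒳) 2

/-! ## §5 Registered stubs (`sorry` occurs nowhere else in this file) -/

/-- STUB 1 (registered; hardest): see `CoherentCrossSeedExists`. -/
theorem stub_coherentCrossSeed : CoherentCrossSeedExists := by
  sorry

/-- STUB 2 (registered): see `SecondWeilDirection`. -/
theorem stub_secondWeilDirection : SecondWeilDirection := by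
  sorry

/-- STUB 3 (registered): see `LocallyFreeUpgrade`. -/
theorem stub_locallyFreeUpgrade : LocallyFreeUpgrade := by
  sorry

/-- STUB 4 (registered): see `ZeroOneAvoidance`. -/
theorem stub_zeroOneAvoidance : ZeroOneAvoidance := by
  sorry

/-- STUB 5 (registered): see `ThetaHatchLefschetz`. -/
theorem stub_thetaHatchLefschetz : ThetaHatchLefschetz := by
  sorry

/-! ### Name-keyed aliases of the five statements (the hypotheses of the composition; same device as
`Cruxes/MazurKaneLaw/Lines/fibre-toolkit-lp-wall-map.lean` — the skeleton audit admits hypotheses of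
`_of` BY NAME of a registered stub) -/
namespace Registered

/-- Alias of `CoherentCrossSeedExists` keyed by the registered stub name. -/
abbrev stub_coherentCrossSeed : Prop := CoherentCrossSeedExists
/-- Alias of `SecondWeilDirection` keyed by the registered stub name. -/
abbrev stub_secondWeilDirection : Prop := SecondWeilDirection
/-- Alias of `LocallyFreeUpgrade` keyed by the registered stub name. -/
abbrev stub_locallyFreeUpgrade : Prop := LocallyFreeUpgrade
/-- Alias of `ZeroOneAvoidance` keyed by the registered stub name. -/
abbrev stub_zeroOneAvoidance : Prop := ZeroOneAvoidance
/-- Alias of `ThetaHatchLefschetz` keyed by the registered stub name. -/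
abbrev stub_thetaHatchLefschetz : Prop := ThetaHatchLefschetz

end Registered

/-! ## §6 Glue (proved) -/

section Glue

variable {p : ℕ} [Fact p.Prime] {k : Type u} [Field k] [CharP k p] [PerfectRing k p]
variable {C : CrystallineRealization p k}

/-- The theta span satisfies the Hodge condition: its generators `[Θ^t]` are restrictions of
(rank-one) vector bundles on `𝒳` (`liftsTheta`, `hodgeCondition_of_liftsTo`). -/
theorem thetaSpan_le_hodgeSubmodule (A : WeilProductAnchor C) :
    A.D.thetaSpan ≤ hodgeSubmodule C A.𝒳 := by
  refine Submodule.span_le.mpr ?_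
  rintro x ⟨t, h, ht, rfl⟩
  rw [SetLike.mem_coe, mem_hodgeSubmodule_iff, CrystallineRealization.hodgeConditionKZeroRat_of]
  obtain ⟨L, hL, ⟨eL⟩⟩ := A.liftsTheta t ht
  exact C.hodgeCondition_of_liftsTo A.model
    ⟨L, hL.hasRankLE.isFiniteLocallyFree.isVectorBundle, ⟨eL⟩⟩

/-- Every class in `ℚ[Θ] ⊕ E_W` satisfies the Hodge condition on the anchor
(theta part: lifts; Weil part: the `weilDisc` hypothesis). -/
theorem sup_le_hodgeSubmodule (A : WeilProductAnchor C) :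
    A.D.thetaSpan ⊔ A.D.weilEigenspace ≤ hodgeSubmodule C A.𝒳 :=
  sup_le (thetaSpan_le_hodgeSubmodule A) A.weilDisc

/-- A finite locally free seed with class in `ℚ[Θ] ⊕ E_W` satisfies BEK's Hodge condition on `𝒳`. -/
theorem hodgeCondition_of_mem (A : WeilProductAnchor C) {F : (specialFibre A.𝒳).left.Modules}
    (hF : IsFiniteLocallyFree F) (hmem : KZeroRat.of F hF ∈ A.D.thetaSpan ⊔ A.D.weilEigenspace) :
    C.HodgeCondition A.𝒳 F := by
  have hm : KZeroRat.of F hF ∈ hodgeSubmodule C A.𝒳 := sup_le_hodgeSubmodule A hmem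
  rwa [mem_hodgeSubmodule_iff, CrystallineRealization.hodgeConditionKZeroRat_of] at hm

end Glue

/-! ## §7 The composition (kernel-checked, no `sorry`) -/

/-- **`CrossOrbitSeedsOnWeilFourfoldAnchors_of`** — the five stubs imply the typed conclusion, by
name: one coherent seed (STUB 1) ⇒ two spanning ones (STUB 2) ⇒ locally free (STUB 3) ⇒ `{0,1}`-
semiregular (STUB 4), all ON the special fibre; glue: `{0,1}` ⇒ p-adic semiregularity for every `Θ`
(TypedCrux), Hodge condition from class membership, and the `K`-span bookkeeping
`weilTarget ≤ thetaHatch ⊔ K⟨bo ch₂ F₁, bo ch₂ F₂⟩` with STUB 5 `thetaHatch ≤ Lef²(X_K)`. -/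
theorem CrossOrbitSeedsOnWeilFourfoldAnchors_of (h₁ : Registered.stub_coherentCrossSeed)
    (h₂ : Registered.stub_secondWeilDirection) (h₃ : Registered.stub_locallyFreeUpgrade)
    (h₄ : Registered.stub_zeroOneAvoidance) (h₅ : Registered.stub_thetaHatchLefschetz) :
    CrossOrbitSeedsOnWeilFourfoldAnchors := by
  intro p _ k _ _ _ _ hp C hLB Θ A α hα
  obtain ⟨F₁, F₂, hF₁, hF₂, s₁, s₂, m₁, m₂, hspan⟩ :=
    h₄ p k hp _ A.D (h₃ p k hp _ A.D (h₂ p k hp _ A.D (h₁ p k hp _ A.D)))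
  refine ⟨2, ![F₁, F₂], ?_, ?_, ?_⟩
  · intro i
    fin_cases i
    · exact hF₁
    · exact hF₂
  · intro i
    fin_cases i
    · exact ⟨isPadicSemiregular_of_isZeroOneSemiregular Θ p _ hF₁ s₁,
        hodgeCondition_of_mem A hF₁ m₁⟩
    · exact ⟨isPadicSemiregular_of_isZeroOneSemiregular Θ p _ hF₂ s₂,
        hodgeCondition_of_mem A hF₂ m₂⟩
  · -- the span bookkeeping on the generic fibre
    have hW : A.D.weilEigenspace ≤
        A.D.thetaSpan ⊔ ((ℚ ∙ KZeroRat.of F₁ hF₁) ⊔ (ℚ ∙ KZeroRat.of F₂ hF₂)) := by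
      rwa [← sup_assoc]
    have hT : thetaHatch A ≤ C.dR.lefschetzClasses (genericFibre A.𝒳) 2 := h₅ p k C hLB A
    have hα' := span_image_le_of_le_sup (K' := K(p, k)) (boch C A.𝒳 2) hW hα
    rw [Submodule.mem_sup] at hα'
    obtain ⟨y, hy, z, hz, rfl⟩ := hα'
    rw [sup_comm]
    refine Submodule.add_mem_sup (hT hy) ?_
    have hz' := span_image_le_of_le_sup (K' := K(p, k)) (boch C A.𝒳 2) (le_refl _) hz
    have hle : Submodule.span K(p, k) (boch C A.𝒳 2 ''
          ((ℚ ∙ KZeroRat.of F₁ hF₁ : Submodule ℚ _) : Set _)) ⊔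
        Submodule.span K(p, k) (boch C A.𝒳 2 ''
          ((ℚ ∙ KZeroRat.of F₂ hF₂ : Submodule ℚ _) : Set _)) ≤
        Submodule.span K(p, k) (Set.range fun i : Fin 2 => C.bo A.𝒳 (2 * 2)
          (C.chCris (specialFibre A.𝒳) ((![F₁, F₂]) i) 2)) := by
      refine sup_le ?_ ?_
      · refine (span_image_span_singleton_le _ (boch_smul C A.𝒳 2) _).trans ?_
        refine Submodule.span_mono ?_
        rintro _ ⟨rfl⟩
        refine ⟨0, ?_⟩
        simp only [boch_apply, CrystallineRealization.chKZeroRat_of]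
        rfl
      · refine (span_image_span_singleton_le _ (boch_smul C A.𝒳 2) _).trans ?_
        refine Submodule.span_mono ?_
        rintro _ ⟨rfl⟩
        refine ⟨1, ?_⟩
        simp only [boch_apply, CrystallineRealization.chKZeroRat_of]
        rfl
    exact hle hz'

/-- Wiring check: the registered stubs feed the composition as stated. -/
example : CrossOrbitSeedsOnWeilFourfoldAnchors :=
  CrossOrbitSeedsOnWeilFourfoldAnchors_of stub_coherentCrossSeed stub_secondWeilDirection
    stub_locallyFreeUpgrade stub_zeroOneAvoidance stub_thetaHatchLefschetz

end Summit.HodgeConjecture.HodgeConjecture.Cruxes.SemiregularSeedsOnAnchors.CrossIdealOrbitTransport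

end
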